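import Mathlib
import Summits.PneNP.PneNP.Theses.ClusUniversalCertificate

/-!
# Route ClusUniversalCertificate, item `PolylogGivesCapped` — PolyLoss implies the capped door

Closes the support item `stmt-PneNP-19685`
(`Summit.PneNP.PneNP.Theses.ClusUniversalCertificate.PolylogGivesCapped`, rung F-N1 of the PneNP
frontier ladder, cell pnp-ideate, planner p1; NOT summit-closing and with no bearing on `P ≠ NP` by
itself): the `c`-free "PolyLoss" form of closure-local union stability — for all large `N` some `f`
with properties (i),(ii) makes every family of rank-`≤ w ≤ w_N` systems retaining all but a
`μ_N = (log₂ N)^C / N^{k−1−ε}` fraction of every closure piece lose at most a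
`(log₂ N)^{C'} / N^{k−1−ε}` fraction of the nice union — implies the capped door `ClusExistsCapped`
(loss `μ_N^c` at some admissible `c` with `(k−1−ε)c > 2`, families of at most `g_N` members).

Proof (cell record HOME/pnp-ideate-lit/ClosureLocalUnionStabilityTheorems.lean, lemmas
`clusExists_of_polylog`, `exists_muOf_le_rpow`, `clusExistsCapped_of_exists`, here re-targeted at the
route declaration BY NAME): choose `c` midway between `2/(k−1−ε)` and `1` (possible since `k ≥ 4`,
`ε < 1`); a polylogarithm is eventually below every positive power, so
`μ_N(C') ≤ μ_N(C)^c` for large `N` (`exists_muOf_le_rpow`); stability is monotone in the loss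
parameter (`at_mono_lam`) and the member cap only weakens it (`capped_of_at`). [folklore]
-/

set_option linter.dupNamespace false -- `Summit.PneNP.PneNP.…`: summit = sub-problem name (D-0017 single-conjunct layout)

namespace Summit.PneNP.PneNP.Theorems.ClusUniversalCertificatePolylogGivesCapped

open Literature.Computability.MetaComplexity Literature.Computability.MetaComplexity.CLUS

/-- The member-count-free form implies the capped form for every cap `g`. [folklore] -/
theorem capped_of_at {N m k : ℕ} {f : (Fin k → Hole m) → Hole m} {w : ℕ} {μ lam : ℝ}
    (h : ClosureLocalUnionStableAt N m k f w μ lam) (g : ℕ) :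
    ClosureLocalUnionStableCapped N m k f w g μ lam :=
  fun ι hι _ L ℓ => h ι hι L ℓ

/-- Monotonicity of `FamilyStable` in the union-loss parameter. [folklore] -/
theorem familyStable_mono_lam {N m k : ℕ} {f : (Fin k → Hole m) → Hole m} {w : ℕ} {μ lam lam' : ℝ}
    {ι : Type} {L : ι → Finset LinLit} {ℓ : ι → Finset ℕ}
    (h : FamilyStable N m k f w μ lam ι L ℓ) (hle : lam ≤ lam') :
    FamilyStable N m k f w μ lam' ι L ℓ := by
  intro h1 h2 h3
  have h4 := h h1 h2 h3
  have hU : (0 : ℝ) ≤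
      (({σ : Fin (N * m) → Bool | ∃ i, Nice N m k f (L i) (ext (N * m) σ)} : Set _).ncard : ℝ) :=
    Nat.cast_nonneg _
  calc (1 - lam') *
        (({σ : Fin (N * m) → Bool | ∃ i, Nice N m k f (L i) (ext (N * m) σ)} : Set _).ncard : ℝ)
      ≤ (1 - lam) *
        (({σ : Fin (N * m) → Bool | ∃ i, Nice N m k f (L i) (ext (N * m) σ)} : Set _).ncard : ℝ) :=
        mul_le_mul_of_nonneg_right (by linarith) hU
    _ ≤ _ := h4

/-- `ClosureLocalUnionStableAt` is monotone in the union-loss parameter. [folklore] -/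
theorem at_mono_lam {N m k : ℕ} {f : (Fin k → Hole m) → Hole m} {w : ℕ} {μ lam lam' : ℝ}
    (h : ClosureLocalUnionStableAt N m k f w μ lam) (hle : lam ≤ lam') :
    ClosureLocalUnionStableAt N m k f w μ lam' :=
  fun ι hι L ℓ => familyStable_mono_lam (h ι hι L ℓ) hle

/-- `polylog ≤ power`, eventually: `(log₂ x)^e ≤ x^δ` for all large real `x` (`δ > 0`, any real `e`).
[folklore] -/
theorem eventually_logb_rpow_le (e δ : ℝ) (hδ : 0 < δ) :
    ∀ᶠ x : ℝ in Filter.atTop, (Real.logb 2 x) ^ e ≤ x ^ δ := by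
  rcases le_or_gt e 0 with he | he
  · filter_upwards [Filter.eventually_ge_atTop (2 : ℝ)] with x hx
    have hL : 1 ≤ Real.logb 2 x := by
      rw [Real.le_logb_iff_rpow_le one_lt_two (by linarith), Real.rpow_one]; exact hx
    calc (Real.logb 2 x) ^ e ≤ 1 := Real.rpow_le_one_of_one_le_of_nonpos hL he
      _ ≤ x ^ δ := Real.one_le_rpow (by linarith) hδ.le
  · have hl2 : 0 < Real.log 2 := Real.log_pos one_lt_two
    have hlo := (isLittleO_log_rpow_rpow_atTop e hδ).bound (Real.rpow_pos_of_pos hl2 e)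
    filter_upwards [hlo, Filter.eventually_ge_atTop (1 : ℝ)] with x hx hx1
    have hl : 0 ≤ Real.log x := Real.log_nonneg hx1
    rw [Real.norm_eq_abs, Real.norm_eq_abs, abs_of_nonneg (Real.rpow_nonneg hl e),
      abs_of_nonneg (Real.rpow_nonneg (by linarith) _)] at hx
    have hq : Real.logb 2 x ^ e = Real.log x ^ e / Real.log 2 ^ e := by
      rw [Real.logb, Real.div_rpow hl hl2.le]
    rw [hq, div_le_iff₀ (Real.rpow_pos_of_pos hl2 e)]
    linarith [mul_comm (Real.log 2 ^ e) (x ^ δ)]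

/-- The polylogarithmic-numerator loss is eventually below every power `c < 1` of the Lemma-4.6 loss:
for `0 < k − 1 − ε` and `c < 1` there is `N₁` with `muOf k ε C' N ≤ (muOf k ε C N)^c` for all
`N ≥ N₁` (a polylog is eventually below `N^{(k−1−ε)(1−c)}`). [folklore] -/
theorem exists_muOf_le_rpow (k : ℕ) (ε C C' c : ℝ) (ha : 0 < (k : ℝ) - 1 - ε) (hc1 : c < 1) :
    ∃ N₁ : ℕ, ∀ N : ℕ, N₁ ≤ N → muOf k ε C' N ≤ (muOf k ε C N) ^ c := by
  have hδ : 0 < ((k : ℝ) - 1 - ε) * (1 - c) := mul_pos ha (by linarith)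
  have hev := (eventually_logb_rpow_le (C' - C * c) _ hδ).and (Filter.eventually_ge_atTop (2 : ℝ))
  obtain ⟨N₁, hN₁⟩ := Filter.eventually_atTop.1 (tendsto_natCast_atTop_atTop.eventually hev)
  refine ⟨N₁, fun N hN => ?_⟩
  obtain ⟨hx, hx2⟩ := hN₁ N hN
  have hNpos : (0 : ℝ) < N := by linarith
  have hL1 : 1 ≤ Real.logb 2 (N : ℝ) := by
    rw [Real.le_logb_iff_rpow_le one_lt_two hNpos, Real.rpow_one]; exact hx2
  have hL0 : 0 ≤ Real.logb 2 (N : ℝ) := by linarith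
  have hLpos : 0 < Real.logb 2 (N : ℝ) := by linarith
  unfold muOf
  rw [Real.div_rpow (Real.rpow_nonneg hL0 C) (Real.rpow_nonneg hNpos.le _), ← Real.rpow_mul hL0,
    ← Real.rpow_mul hNpos.le]
  have hsplit : (N : ℝ) ^ ((k : ℝ) - 1 - ε)
      = (N : ℝ) ^ (((k : ℝ) - 1 - ε) * c) * (N : ℝ) ^ (((k : ℝ) - 1 - ε) * (1 - c)) := by
    rw [← Real.rpow_add hNpos]; congr 1; ring
  have hLsplit : Real.logb 2 (N : ℝ) ^ C'
      = Real.logb 2 (N : ℝ) ^ (C * c) * Real.logb 2 (N : ℝ) ^ (C' - C * c) := by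
    rw [← Real.rpow_add hLpos]; congr 1; ring
  rw [hsplit, hLsplit, mul_div_mul_comm]
  have hfrac : Real.logb 2 (N : ℝ) ^ (C' - C * c) / (N : ℝ) ^ (((k : ℝ) - 1 - ε) * (1 - c)) ≤ 1 :=
    (div_le_one (Real.rpow_pos_of_pos hNpos _)).2 hx
  have hnn : 0 ≤ Real.logb 2 (N : ℝ) ^ (C * c) / (N : ℝ) ^ (((k : ℝ) - 1 - ε) * c) :=
    div_nonneg (Real.rpow_nonneg hL0 _) (Real.rpow_nonneg hNpos.le _)
  calc Real.logb 2 (N : ℝ) ^ (C * c) / (N : ℝ) ^ (((k : ℝ) - 1 - ε) * c)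
        * (Real.logb 2 (N : ℝ) ^ (C' - C * c) / (N : ℝ) ^ (((k : ℝ) - 1 - ε) * (1 - c)))
      ≤ Real.logb 2 (N : ℝ) ^ (C * c) / (N : ℝ) ^ (((k : ℝ) - 1 - ε) * c) * 1 :=
        mul_le_mul_of_nonneg_left hfrac hnn
    _ = _ := mul_one _

/-- **PolyLoss implies the capped door** — closes item `stmt-PneNP-19685` BY NAME: choose
`c = (2/(k−1−ε) + 1)/2`, bound the polylogarithmic loss by `μ_N^c` eventually, and cap.
[folklore; cell record ROUND-2 §3 / companion file `clusExists_of_polylog` + `clusExistsCapped_of_exists`] -/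
theorem polylogGivesCapped_holds :
    Summit.PneNP.PneNP.Theses.ClusUniversalCertificate.PolylogGivesCapped := by
  intro h
  obtain ⟨q, hq, k, hk, ε, he0, he1, C, C', N₀, hN⟩ := h
  have hk4 : (4 : ℝ) ≤ k := by exact_mod_cast hk
  have ha : 2 < (k : ℝ) - 1 - ε := by linarith
  have hapos : 0 < (k : ℝ) - 1 - ε := by linarith
  have h2a : 2 / ((k : ℝ) - 1 - ε) < 1 := by rw [div_lt_one hapos]; exact ha
  have h2a0 : 0 < 2 / ((k : ℝ) - 1 - ε) := div_pos two_pos hapos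
  have hlt : 2 / ((k : ℝ) - 1 - ε) < (2 / ((k : ℝ) - 1 - ε) + 1) / 2 := by linarith
  obtain ⟨N₁, hN₁⟩ := exists_muOf_le_rpow k ε C C' ((2 / ((k : ℝ) - 1 - ε) + 1) / 2) hapos
    (by linarith)
  refine ⟨q, hq, (2 / ((k : ℝ) - 1 - ε) + 1) / 2, by linarith, by linarith, k, by omega, ε, he0, he1,
    ?_, C, max N₀ N₁, fun N hN' => ?_⟩
  · calc (2 : ℝ) = ((k : ℝ) - 1 - ε) * (2 / ((k : ℝ) - 1 - ε)) := by field_simp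
      _ < ((k : ℝ) - 1 - ε) * ((2 / ((k : ℝ) - 1 - ε) + 1) / 2) := mul_lt_mul_of_pos_left hlt hapos
  · obtain ⟨f, h1, h2, h3⟩ := hN N (le_trans (le_max_left _ _) hN')
    exact ⟨f, h1, h2, fun w hw =>
      capped_of_at (at_mono_lam (h3 w hw) (hN₁ N (le_trans (le_max_right _ _) hN'))) _⟩

end Summit.PneNP.PneNP.Theorems.ClusUniversalCertificatePolylogGivesCapped
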